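import Mathlib.Analysis.SpecificLimits.Basic
import Literature.Barriers.Parity.SiegelZeroGoldbachGenFn
import Literature.Barriers.Parity.SiegelZeroPrimePairsTheorem2
import HarnessLib

/-!
# Goldston–Suriajaya, Theorem 1: the prime side `∑_b Ψ(ρ; q, b)Ψ(ρ; q, −b)` (§4), proved

Sibling of `Literature/Barriers/Parity/SiegelZeroPrimePairs.lean` (Goldston–Suriajaya,
arXiv:2104.09407, Theorem 1 = the named fact `Literature.Barriers.Parity.GoldstonSuriajaya2021_goldbach`).
Everything in this file is PROVED. It is the power-series form of §4 of the source
("Evaluating `𝒮(q)` using the prime number theorem for arithmetic progressions"), for a real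
weight `0 ≤ ρ < 1` and abstract main terms:

* `mainM ρ Φ = ρ/((1 − ρ)Φ) = (1 − ρ)∑_n (n/Φ)ρⁿ` and
  `excS ρ β Φ = (1 − ρ)∑_n n^β ρⁿ/(Φβ)` — the images of the two main terms `x/φ(q)` and
  `x^β/(φ(q)β)` of (PNTAP) under the partial summation `Ψ(ρ; q, b) = (1 − ρ)∑_n ψ(n; q, b)ρⁿ`
  (GS21 (PsiAP): `Ψ(r; q, b) = N/φ(q) + χ₁(b)Γ(β₁)N^{β₁}/φ(q) + O(Ne^{−c₁√log N})`; here no Gamma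
  function is evaluated — only the bounds `excS_le`, `excS_ge` are proved);
* `psiGen_sub_main_le` — if `|ψ(n; q, b) − n/Φ + ε n^β/(Φβ)| ≤ 3 + K n w(n)` for all `n`, with a
  weight `0 ≤ w ≤ 1` that is `≤ w₀` from `Y` on, then
  `|Ψ(ρ; q, b) − (M − εS)| ≤ 3 + KY²(1 − ρ) + K w₀ ρ/(1 − ρ)` (GS21 (PsiAP) with its error term);
* `genPairSum_ge_of_even` — for an EVEN real character `χ ≠ χ₀` (`χ(−1) = 1`):
  `∑_b Ψ_b Ψ_{−b} ≥ φ(q)(M² + S² − 2(M + S)E − E²)` (GS21 (Sq4) with `χ(−1) = 1`, as a lower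
  bound: the cross terms cancel because `∑_b χ(b) = 0`);
* `genPairSum_le_of_odd` — for an ODD real character (`χ(−1) = −1`):
  `∑_b Ψ_b Ψ_{−b} ≤ φ(q)(M² − S² + 2(M + S)E + E²) + Z₀²`, `Z₀ = ∑_{(b,q) > 1} Ψ_b` (GS21 (Sq4)
  with `χ(−1) = −1`, as an upper bound, together with (Sq3): the classes `(b, q) > 1`).

The size of `Z₀` (GS21 (Psi(d>1))) is bounded in `SiegelZeroGoldbachNonUnit.lean`; the Goldbach
side is `SiegelZeroGoldbachSingular.lean`; the assembly is `SiegelZeroGoldbachTheorem1.lean`.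

## References

* D. A. Goldston, A. I. Suriajaya, *Note on the Goldbach conjecture and Landau–Siegel zeros*,
  arXiv:2104.09407 (2021), §4: (PNTAP), (gamma), (PsiAP), (Sq3), (Sq4); §5 (key).
  [cite: GoldstonSuriajaya2021, §4]
-/

noncomputable section

open Finset Real
open scoped ArithmeticFunction.vonMangoldt

namespace Literature.Barriers.Parity

namespace GoldstonSuriajaya

open Literature.NumberTheory.Sieve

variable {ρ : ℝ}

/-! ### Closed forms for `∑ ρⁿ`, `∑ n ρⁿ` and the tail `∑_{n ≥ U} n ρⁿ` -/

/-- `∑_n ρⁿ = 1/(1 − ρ)`. [folklore] -/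
theorem tsum_pow_eq (hρ0 : 0 ≤ ρ) (hρ1 : ρ < 1) : ∑' n : ℕ, ρ ^ n = 1 / (1 - ρ) := by
  rw [tsum_geometric_of_lt_one hρ0 hρ1, one_div]

/-- `∑_n n ρⁿ = ρ/(1 − ρ)²`. [folklore] -/
theorem tsum_nat_mul_pow_eq (hρ0 : 0 ≤ ρ) (hρ1 : ρ < 1) :
    ∑' n : ℕ, (n : ℝ) * ρ ^ n = ρ / (1 - ρ) ^ 2 :=
  tsum_coe_mul_geometric_of_norm_lt_one (by rwa [Real.norm_of_nonneg hρ0])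

/-- The tail `∑_{n ≥ U} n ρⁿ = ρ^U (ρ/(1 − ρ)² + U/(1 − ρ))`. [folklore] -/
theorem tsum_tail_nat_mul_pow_eq (hρ0 : 0 ≤ ρ) (hρ1 : ρ < 1) (U : ℕ) :
    ∑' i : ℕ, ((i + U : ℕ) : ℝ) * ρ ^ (i + U) = ρ ^ U * (ρ / (1 - ρ) ^ 2 + U * (1 / (1 - ρ))) := by
  have h1 : Summable (fun i : ℕ => (i : ℝ) * ρ ^ i) := by
    simpa using summable_pow_mul_pow hρ0 hρ1 1
  have h0 : Summable (fun i : ℕ => ρ ^ i) := summable_geometric_of_lt_one hρ0 hρ1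
  have heq : ∀ i : ℕ, ((i + U : ℕ) : ℝ) * ρ ^ (i + U) =
      ρ ^ U * ((i : ℝ) * ρ ^ i) + ρ ^ U * U * ρ ^ i := by
    intro i
    push_cast
    rw [pow_add]
    ring
  simp_rw [heq]
  rw [(h1.mul_left _).tsum_add (h0.mul_left _), tsum_mul_left, tsum_mul_left,
    tsum_nat_mul_pow_eq hρ0 hρ1, tsum_pow_eq hρ0 hρ1]
  ring

/-- The head `∑_{n < U} n ρⁿ = ρ/(1 − ρ)² − ρ^U(ρ/(1 − ρ)² + U/(1 − ρ))`. [folklore] -/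
theorem sum_range_nat_mul_pow_eq (hρ0 : 0 ≤ ρ) (hρ1 : ρ < 1) (U : ℕ) :
    ∑ n ∈ range U, (n : ℝ) * ρ ^ n =
      ρ / (1 - ρ) ^ 2 - ρ ^ U * (ρ / (1 - ρ) ^ 2 + U * (1 / (1 - ρ))) := by
  have h1 : Summable (fun i : ℕ => (i : ℝ) * ρ ^ i) := by
    simpa using summable_pow_mul_pow hρ0 hρ1 1
  have h := h1.sum_add_tsum_nat_add U
  rw [tsum_nat_mul_pow_eq hρ0 hρ1] at h
  have ht := tsum_tail_nat_mul_pow_eq hρ0 hρ1 U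
  have ht' : ∑' i : ℕ, ((i + U : ℕ) : ℝ) * ρ ^ (i + U) = ∑' i : ℕ, ((↑(i + U) : ℝ)) * ρ ^ (i + U) :=
    rfl
  linarith [ht, h]

/-- A tail of `∑ n ρⁿ` with weights `≤ 1` is at most the whole sum: for `0 ≤ v ≤ 1`,
`∑_i (i + Y) v(i + Y) ρ^{i+Y} ≤ ρ/(1 − ρ)²`. [folklore] -/
theorem tsum_tail_weight_le (hρ0 : 0 ≤ ρ) (hρ1 : ρ < 1) (Y : ℕ) {v : ℕ → ℝ} (hv0 : ∀ n, 0 ≤ v n)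
    (hv1 : ∀ n, v n ≤ 1) :
    ∑' i : ℕ, ((i + Y : ℕ) : ℝ) * v (i + Y) * ρ ^ (i + Y) ≤ ρ / (1 - ρ) ^ 2 := by
  have h1 : Summable (fun i : ℕ => (i : ℝ) * ρ ^ i) := by
    simpa using summable_pow_mul_pow hρ0 hρ1 1
  have h1t : Summable (fun i : ℕ => ((i + Y : ℕ) : ℝ) * ρ ^ (i + Y)) :=
    (summable_nat_add_iff Y).mpr h1
  have hle : ∀ i : ℕ, ((i + Y : ℕ) : ℝ) * v (i + Y) * ρ ^ (i + Y) ≤ ((i + Y : ℕ) : ℝ) * ρ ^ (i + Y) := by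
    intro i
    have h := mul_le_of_le_one_right (by positivity : (0 : ℝ) ≤ ((i + Y : ℕ) : ℝ) * ρ ^ (i + Y))
      (hv1 (i + Y))
    calc ((i + Y : ℕ) : ℝ) * v (i + Y) * ρ ^ (i + Y) = ((i + Y : ℕ) : ℝ) * ρ ^ (i + Y) * v (i + Y) := by
          ring
      _ ≤ ((i + Y : ℕ) : ℝ) * ρ ^ (i + Y) := h
  have hsv : Summable (fun i : ℕ => ((i + Y : ℕ) : ℝ) * v (i + Y) * ρ ^ (i + Y)) :=
    h1t.of_nonneg_of_le (fun i => by have := hv0 (i + Y); positivity) hle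
  calc ∑' i : ℕ, ((i + Y : ℕ) : ℝ) * v (i + Y) * ρ ^ (i + Y)
      ≤ ∑' i : ℕ, ((i + Y : ℕ) : ℝ) * ρ ^ (i + Y) := hsv.tsum_le_tsum hle h1t
    _ ≤ ∑' i : ℕ, (i : ℝ) * ρ ^ i := by
        rw [← h1.sum_add_tsum_nat_add Y]
        have : 0 ≤ ∑ i ∈ range Y, (i : ℝ) * ρ ^ i := sum_nonneg fun i _ => by positivity
        linarith
    _ = ρ / (1 - ρ) ^ 2 := tsum_nat_mul_pow_eq hρ0 hρ1

/-! ### The main terms `M` and `S` -/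

/-- `M = ρ/((1 − ρ)Φ) = (1 − ρ)∑_n (n/Φ)ρⁿ`: the image of the main term `x/φ(q)` of the prime
number theorem for progressions under `Ψ(ρ; q, b) = (1 − ρ)∑_n ψ(n; q, b)ρⁿ` (GS21 (PsiAP): the
term `N/φ(q)`). [cite: GoldstonSuriajaya2021, §4 (PsiAP)] -/
def mainM (ρ Φ : ℝ) : ℝ := ρ / ((1 - ρ) * Φ)

/-- `S = (1 − ρ)∑_n n^β ρⁿ/(Φβ)`: the image of the exceptional term `x^β/(φ(q)β)` (GS21 (PsiAP):
the term `Γ(β₁)N^{β₁}/φ(q)`). [cite: GoldstonSuriajaya2021, §4 (PsiAP)] -/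
def excS (ρ β Φ : ℝ) : ℝ := (1 - ρ) * ∑' n : ℕ, (n : ℝ) ^ β * ρ ^ n / (Φ * β)

/-- `(1 − ρ)∑_n (n/Φ) ρⁿ = M`. [folklore] -/
theorem one_sub_mul_tsum_div_eq_mainM (hρ0 : 0 ≤ ρ) (hρ1 : ρ < 1) (Φ : ℝ) :
    (1 - ρ) * ∑' n : ℕ, (n : ℝ) / Φ * ρ ^ n = mainM ρ Φ := by
  have h : ∀ n : ℕ, (n : ℝ) / Φ * ρ ^ n = (1 / Φ) * ((n : ℝ) * ρ ^ n) := fun n => by ring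
  simp_rw [h]
  rw [tsum_mul_left, tsum_nat_mul_pow_eq hρ0 hρ1, mainM]
  have h1 : (1 - ρ) ≠ 0 := by linarith
  field_simp

/-- `n^β ≤ n` for natural `n` and `0 < β ≤ 1`. [folklore] -/
theorem natCast_rpow_le_self {β : ℝ} (hβ0 : 0 < β) (hβ1 : β ≤ 1) (n : ℕ) :
    (n : ℝ) ^ β ≤ n := by
  rcases Nat.eq_zero_or_pos n with rfl | hn
  · rw [Nat.cast_zero, Real.zero_rpow hβ0.ne']
  · exact Real.rpow_le_self_of_one_le (by exact_mod_cast hn) hβ1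

/-- `∑_n n^β ρⁿ` converges for `0 ≤ ρ < 1`, `0 < β ≤ 1`. [folklore] -/
theorem summable_rpow_mul_pow (hρ0 : 0 ≤ ρ) (hρ1 : ρ < 1) {β : ℝ} (hβ0 : 0 < β) (hβ1 : β ≤ 1) :
    Summable (fun n : ℕ => (n : ℝ) ^ β * ρ ^ n) :=
  summable_mul_pow_of_le hρ0 hρ1 1 (C := 1) (fun n => by positivity) fun n => by
    rw [one_mul, pow_one]
    exact natCast_rpow_le_self hβ0 hβ1 n

/-- `S ≥ 0`. [folklore] -/
theorem excS_nonneg (hρ0 : 0 ≤ ρ) (hρ1 : ρ ≤ 1) {β Φ : ℝ} (hβ0 : 0 ≤ β) (hΦ : 0 ≤ Φ) :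
    0 ≤ excS ρ β Φ :=
  mul_nonneg (by linarith) (tsum_nonneg fun n => by positivity)

/-- `M ≥ 0`. [folklore] -/
theorem mainM_nonneg (hρ0 : 0 ≤ ρ) (hρ1 : ρ ≤ 1) {Φ : ℝ} (hΦ : 0 ≤ Φ) : 0 ≤ mainM ρ Φ := by
  unfold mainM
  apply div_nonneg hρ0
  exact mul_nonneg (by linarith) hΦ

/-- **Upper bound for the exceptional term**: `S ≤ M/β` (from `n^β ≤ n`; GS21 use
`Γ(β₁) = 1 + O(1/log q)` instead). [cite: GoldstonSuriajaya2021, §5 (after (key))] -/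
theorem excS_le (hρ0 : 0 ≤ ρ) (hρ1 : ρ < 1) {β Φ : ℝ} (hβ0 : 0 < β) (hβ1 : β ≤ 1) (hΦ : 0 < Φ) :
    excS ρ β Φ ≤ mainM ρ Φ / β := by
  unfold excS
  have hs := summable_rpow_mul_pow hρ0 hρ1 hβ0 hβ1
  have h1 : Summable (fun i : ℕ => (i : ℝ) * ρ ^ i) := by
    simpa using summable_pow_mul_pow hρ0 hρ1 1
  have hle : ∑' n : ℕ, (n : ℝ) ^ β * ρ ^ n / (Φ * β) ≤ (∑' n : ℕ, (n : ℝ) * ρ ^ n) / (Φ * β) := by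
    rw [tsum_div_const]
    refine div_le_div_of_nonneg_right (hs.tsum_le_tsum (fun n => ?_) h1) (by positivity)
    exact mul_le_mul_of_nonneg_right (natCast_rpow_le_self hβ0 hβ1 n) (pow_nonneg hρ0 n)
  rw [tsum_nat_mul_pow_eq hρ0 hρ1] at hle
  have h1ρ : 0 ≤ 1 - ρ := by linarith
  calc (1 - ρ) * ∑' n : ℕ, (n : ℝ) ^ β * ρ ^ n / (Φ * β) ≤ (1 - ρ) * (ρ / (1 - ρ) ^ 2 / (Φ * β)) :=
        mul_le_mul_of_nonneg_left hle h1ρ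
    _ = mainM ρ Φ / β := by
        unfold mainM
        have : (1 - ρ) ≠ 0 := by linarith
        field_simp

/-- **Lower bound for the exceptional term**: for `U ≥ 1`,
`S ≥ (U^{β−1}/β)(M(1 − ρ^U) − ρ^U U/Φ)` — keep the terms `n < U`, where `n^β ≥ n U^{β−1}`,
and evaluate `∑_{n<U} nρⁿ` (GS21: `Γ(β₁)N^{β₁}`, `Γ(β₁) = 1 + o(1)`).
[cite: GoldstonSuriajaya2021, §5 (after (key))] -/
theorem excS_ge (hρ0 : 0 < ρ) (hρ1 : ρ < 1) {β Φ : ℝ} (hβ0 : 0 < β) (hβ1 : β ≤ 1) (hΦ : 0 < Φ)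
    {U : ℕ} (hU : 1 ≤ U) :
    (U : ℝ) ^ (β - 1) / β * (mainM ρ Φ * (1 - ρ ^ U) - ρ ^ U * U / Φ) ≤ excS ρ β Φ := by
  have hs := summable_rpow_mul_pow hρ0.le hρ1 hβ0 hβ1
  have hU0 : (0 : ℝ) < U := by exact_mod_cast hU
  -- keep the terms `n < U`
  have hhead : ∑ n ∈ range U, (n : ℝ) ^ β * ρ ^ n ≤ ∑' n : ℕ, (n : ℝ) ^ β * ρ ^ n :=
    hs.sum_le_tsum (range U) fun n _ => by positivity
  -- on which `n^β ≥ n U^{β-1}`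
  have hpt : ∀ n ∈ range U, (U : ℝ) ^ (β - 1) * ((n : ℝ) * ρ ^ n) ≤ (n : ℝ) ^ β * ρ ^ n := by
    intro n hn
    rw [mem_range] at hn
    rcases Nat.eq_zero_or_pos n with rfl | hn0
    · simp [Real.zero_rpow hβ0.ne']
    · have hn0' : (0 : ℝ) < n := by exact_mod_cast hn0
      have h1 : (U : ℝ) ^ (β - 1) ≤ (n : ℝ) ^ (β - 1) :=
        Real.rpow_le_rpow_of_nonpos hn0' (by exact_mod_cast hn.le) (by linarith)
      have h2 : (n : ℝ) ^ β = (n : ℝ) ^ (β - 1) * n := by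
        rw [Real.rpow_sub_one hn0'.ne']
        field_simp
      rw [h2]
      have : 0 ≤ (n : ℝ) * ρ ^ n := by positivity
      nlinarith [mul_le_mul_of_nonneg_right h1 this]
  have hsum : (U : ℝ) ^ (β - 1) * ∑ n ∈ range U, (n : ℝ) * ρ ^ n ≤
      ∑ n ∈ range U, (n : ℝ) ^ β * ρ ^ n := by
    rw [mul_sum]
    exact sum_le_sum hpt
  rw [sum_range_nat_mul_pow_eq hρ0.le hρ1 U] at hsum
  -- assemble
  have h1ρ : 0 < 1 - ρ := by linarith
  have hkey : (U : ℝ) ^ (β - 1) * (ρ / (1 - ρ) ^ 2 - ρ ^ U * (ρ / (1 - ρ) ^ 2 + U * (1 / (1 - ρ)))) ≤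
      ∑' n : ℕ, (n : ℝ) ^ β * ρ ^ n := hsum.trans hhead
  have heq : (U : ℝ) ^ (β - 1) / β * (mainM ρ Φ * (1 - ρ ^ U) - ρ ^ U * U / Φ) =
      (1 - ρ) / (Φ * β) *
        ((U : ℝ) ^ (β - 1) * (ρ / (1 - ρ) ^ 2 - ρ ^ U * (ρ / (1 - ρ) ^ 2 + U * (1 / (1 - ρ))))) := by
    unfold mainM
    field_simp
    ring
  have hexc : excS ρ β Φ = (1 - ρ) / (Φ * β) * ∑' n : ℕ, (n : ℝ) ^ β * ρ ^ n := by
    rw [excS, tsum_div_const]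
    ring
  rw [heq, hexc]
  exact mul_le_mul_of_nonneg_left hkey (by positivity)

/-! ### `Ψ(ρ; q, b)` from the prime number theorem with the exceptional term -/

/-- **GS21 (PsiAP), power-series form.** Suppose `|ψ(n; q, b) − n/Φ + ε n^β/(Φβ)| ≤ 3 + K n w(n)`
for every `n`, where `0 ≤ w ≤ 1` and `w(n) ≤ w₀` for `n ≥ Y` (for (PNTAP):
`w(n) = e^{−c₁√log n}`, the `3` absorbing `n ≤ 1`). Then
`|Ψ(ρ; q, b) − (M − εS)| ≤ 3 + KY²(1 − ρ) + K w₀ ρ/(1 − ρ)`.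
[cite: GoldstonSuriajaya2021, §4 (PsiAP)] -/
theorem psiGen_sub_main_le {q : ℕ} (b : ZMod q) {β Φ ε K w₀ : ℝ} {Y : ℕ} {w : ℕ → ℝ}
    (hρ0 : 0 ≤ ρ) (hρ1 : ρ < 1) (hβ0 : 0 < β) (hβ1 : β ≤ 1) (hK : 0 ≤ K)
    (hw0 : ∀ n, 0 ≤ w n) (hw1 : ∀ n, w n ≤ 1) (hwY : ∀ n : ℕ, Y ≤ n → w n ≤ w₀)
    (happrox : ∀ n : ℕ,
      |ParityWave0.chebyshevPsiMod q b n - n / Φ + ε * (n : ℝ) ^ β / (Φ * β)| ≤ 3 + K * n * w n) :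
    |psiGen q b ρ - (mainM ρ Φ - ε * excS ρ β Φ)| ≤
      3 + K * (Y : ℝ) ^ 2 * (1 - ρ) + K * w₀ * (ρ / (1 - ρ)) := by
  have h1ρ : 0 < 1 - ρ := by linarith
  -- the error sequence
  set e : ℕ → ℝ := fun n =>
    ParityWave0.chebyshevPsiMod q b n - n / Φ + ε * (n : ℝ) ^ β / (Φ * β) with hedef
  have hψ : ∀ n : ℕ, ParityWave0.chebyshevPsiMod q b n * ρ ^ n =
      ((n : ℝ) / Φ * ρ ^ n - ε * ((n : ℝ) ^ β * ρ ^ n / (Φ * β))) + e n * ρ ^ n := by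
    intro n
    simp only [hedef]
    ring
  -- summability of the pieces
  have hsM : Summable (fun n : ℕ => (n : ℝ) / Φ * ρ ^ n) := by
    have h1 : Summable (fun i : ℕ => (i : ℝ) * ρ ^ i) := by
      simpa using summable_pow_mul_pow hρ0 hρ1 1
    simpa [div_eq_mul_inv, mul_comm, mul_assoc, mul_left_comm] using h1.mul_left (1 / Φ)
  have hsS : Summable (fun n : ℕ => ε * ((n : ℝ) ^ β * ρ ^ n / (Φ * β))) :=
    ((summable_rpow_mul_pow hρ0 hρ1 hβ0 hβ1).div_const _).mul_left ε
  have hsψ := summable_chebyshevPsiMod_mul_pow q b hρ0 hρ1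
  have hse : Summable (fun n : ℕ => e n * ρ ^ n) := by
    have := hsψ.sub (hsM.sub hsS)
    refine this.congr fun n => ?_
    rw [hψ n]
    ring
  -- the decomposition `Ψ = M − εS + (1 − ρ)∑ e(n)ρⁿ`
  have hdec : psiGen q b ρ - (mainM ρ Φ - ε * excS ρ β Φ) = (1 - ρ) * ∑' n : ℕ, e n * ρ ^ n := by
    rw [psiGen_eq_chebyshev q b hρ0 hρ1, tsum_congr hψ, (hsM.sub hsS).tsum_add hse,
      hsM.tsum_sub hsS, tsum_mul_left, ← one_sub_mul_tsum_div_eq_mainM hρ0 hρ1 Φ, excS]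
    ring
  rw [hdec, abs_mul, abs_of_pos h1ρ]
  -- bound `∑ |e(n)| ρⁿ`
  have hbound : ∀ n : ℕ, ‖e n * ρ ^ n‖ ≤ (3 + K * n * w n) * ρ ^ n := by
    intro n
    rw [Real.norm_eq_abs, abs_mul, abs_of_nonneg (pow_nonneg hρ0 n)]
    exact mul_le_mul_of_nonneg_right (happrox n) (pow_nonneg hρ0 n)
  have hsw : Summable (fun n : ℕ => (n : ℝ) * w n * ρ ^ n) := by
    refine summable_mul_pow_of_le hρ0 hρ1 1 (C := 1) (fun n => ?_) fun n => ?_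
    · have := hw0 n; positivity
    · rw [pow_one, one_mul]
      exact mul_le_of_le_one_right (Nat.cast_nonneg n) (hw1 n)
  have h0 : Summable (fun i : ℕ => ρ ^ i) := summable_geometric_of_lt_one hρ0 hρ1
  have h3eq : ∀ n : ℕ, (3 + K * n * w n) * ρ ^ n = 3 * ρ ^ n + K * ((n : ℝ) * w n * ρ ^ n) :=
    fun n => by ring
  have hs3 : Summable (fun n : ℕ => (3 + K * n * w n) * ρ ^ n) :=
    ((h0.mul_left 3).add (hsw.mul_left K)).congr fun n => (h3eq n).symm
  have hnorm : ‖∑' n : ℕ, e n * ρ ^ n‖ ≤ ∑' n : ℕ, (3 + K * n * w n) * ρ ^ n :=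
    tsum_of_norm_bounded hs3.hasSum hbound
  rw [Real.norm_eq_abs] at hnorm
  -- evaluate / bound `∑ (3 + K n w(n)) ρⁿ`
  have hsplit : ∑' n : ℕ, (3 + K * n * w n) * ρ ^ n =
      3 * (1 / (1 - ρ)) + K * ∑' n : ℕ, (n : ℝ) * w n * ρ ^ n := by
    rw [tsum_congr h3eq, (h0.mul_left 3).tsum_add (hsw.mul_left K), tsum_mul_left, tsum_mul_left,
      tsum_pow_eq hρ0 hρ1]
  have hwsum : ∑' n : ℕ, (n : ℝ) * w n * ρ ^ n ≤ (Y : ℝ) ^ 2 + w₀ * (ρ / (1 - ρ) ^ 2) := by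
    rw [← hsw.sum_add_tsum_nat_add Y]
    have hheadle : ∑ n ∈ range Y, (n : ℝ) * w n * ρ ^ n ≤ (Y : ℝ) ^ 2 := by
      calc ∑ n ∈ range Y, (n : ℝ) * w n * ρ ^ n ≤ ∑ _n ∈ range Y, (Y : ℝ) := by
            refine sum_le_sum fun n hn => ?_
            rw [mem_range] at hn
            have h1 : (n : ℝ) * w n * ρ ^ n ≤ n := by
              have hw := hw1 n
              have hρn : ρ ^ n ≤ 1 := pow_le_one₀ hρ0 hρ1.le
              have := hw0 n
              calc (n : ℝ) * w n * ρ ^ n ≤ (n : ℝ) * 1 * 1 := by gcongr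
                _ = n := by ring
            exact h1.trans (by exact_mod_cast hn.le)
        _ = (Y : ℝ) ^ 2 := by rw [sum_const, card_range, nsmul_eq_mul, sq]
    have htail : ∑' i : ℕ, ((↑(i + Y) : ℝ)) * w (i + Y) * ρ ^ (i + Y) ≤ w₀ * (ρ / (1 - ρ) ^ 2) := by
      by_cases hw₀ : w₀ ≤ 0
      · have hzero : ∀ i : ℕ, ((↑(i + Y) : ℝ)) * w (i + Y) * ρ ^ (i + Y) = 0 := by
          intro i
          have h1 : w (i + Y) ≤ 0 := (hwY (i + Y) (Nat.le_add_left Y i)).trans hw₀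
          have h2 : w (i + Y) = 0 := le_antisymm h1 (hw0 _)
          rw [h2, mul_zero, zero_mul]
        rw [tsum_congr hzero, tsum_zero]
        have : w₀ = 0 := by
          have h1 := (hw0 Y).trans (hwY Y le_rfl)
          linarith
        rw [this, zero_mul]
      · rw [not_le] at hw₀
        have hv : ∑' i : ℕ, ((↑(i + Y) : ℝ)) * (w (i + Y) / w₀) * ρ ^ (i + Y) ≤ ρ / (1 - ρ) ^ 2 := by
          refine tsum_tail_weight_le hρ0 hρ1 Y (v := fun n => if Y ≤ n then w n / w₀ else 0)
            (fun n => ?_) (fun n => ?_) |>.trans_eq' ?_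
          · split_ifs
            · exact div_nonneg (hw0 n) hw₀.le
            · exact le_rfl
          · split_ifs with h
            · exact (div_le_one hw₀).mpr (hwY n h)
            · exact zero_le_one
          · refine tsum_congr fun i => ?_
            rw [if_pos (Nat.le_add_left Y i)]
        have heq : ∑' i : ℕ, ((↑(i + Y) : ℝ)) * w (i + Y) * ρ ^ (i + Y) =
            w₀ * ∑' i : ℕ, ((↑(i + Y) : ℝ)) * (w (i + Y) / w₀) * ρ ^ (i + Y) := by
          rw [← tsum_mul_left]
          refine tsum_congr fun i => ?_
          field_simp
        rw [heq]
        exact mul_le_mul_of_nonneg_left hv hw₀.le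
    linarith
  have hfinal : (1 - ρ) * ∑' n : ℕ, (3 + K * n * w n) * ρ ^ n ≤
      3 + K * (Y : ℝ) ^ 2 * (1 - ρ) + K * w₀ * (ρ / (1 - ρ)) := by
    rw [hsplit]
    have h1 : (1 - ρ) * (3 * (1 / (1 - ρ))) = 3 := by field_simp
    have h2 : (1 - ρ) * (K * ((Y : ℝ) ^ 2 + w₀ * (ρ / (1 - ρ) ^ 2))) =
        K * (Y : ℝ) ^ 2 * (1 - ρ) + K * w₀ * (ρ / (1 - ρ)) := by
      field_simp
    have h3 := mul_le_mul_of_nonneg_left (mul_le_mul_of_nonneg_left hwsum hK) h1ρ.le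
    calc (1 - ρ) * (3 * (1 / (1 - ρ)) + K * ∑' n : ℕ, (n : ℝ) * w n * ρ ^ n)
        = (1 - ρ) * (3 * (1 / (1 - ρ))) + (1 - ρ) * (K * ∑' n : ℕ, (n : ℝ) * w n * ρ ^ n) := by ring
      _ ≤ 3 + (K * (Y : ℝ) ^ 2 * (1 - ρ) + K * w₀ * (ρ / (1 - ρ))) := by
          rw [h1, ← h2]
          linarith
      _ = 3 + K * (Y : ℝ) ^ 2 * (1 - ρ) + K * w₀ * (ρ / (1 - ρ)) := by ring
  exact (mul_le_mul_of_nonneg_left hnorm h1ρ.le).trans hfinal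

/-! ### Summing over the residue classes -/

/-- Product lower bound: `|x − D| ≤ E`, `|y − D| ≤ E`, `|D| ≤ B` give `xy ≥ D² − 2BE − E²`.
[folklore] -/
theorem mul_ge_of_abs_sub_le {x y D E B : ℝ} (hx : |x - D| ≤ E) (hy : |y - D| ≤ E) (hD : |D| ≤ B) :
    D ^ 2 - 2 * B * E - E ^ 2 ≤ x * y := by
  obtain ⟨hx1, hx2⟩ := abs_le.mp hx
  obtain ⟨hy1, hy2⟩ := abs_le.mp hy
  obtain ⟨hD1, hD2⟩ := abs_le.mp hD
  nlinarith [mul_nonneg (by linarith : (0 : ℝ) ≤ B + D) (by linarith : (0 : ℝ) ≤ E + (x - D)),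
    mul_nonneg (by linarith : (0 : ℝ) ≤ B - D) (by linarith : (0 : ℝ) ≤ E - (x - D)),
    mul_nonneg (by linarith : (0 : ℝ) ≤ B + D) (by linarith : (0 : ℝ) ≤ E + (y - D)),
    mul_nonneg (by linarith : (0 : ℝ) ≤ B - D) (by linarith : (0 : ℝ) ≤ E - (y - D)),
    mul_nonneg (by linarith : (0 : ℝ) ≤ E + (x - D)) (by linarith : (0 : ℝ) ≤ E + (y - D)),
    mul_nonneg (by linarith : (0 : ℝ) ≤ E - (x - D)) (by linarith : (0 : ℝ) ≤ E - (y - D))]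

/-- Product upper bound: `|x − D₁| ≤ E`, `|y − D₂| ≤ E`, `|D₁|, |D₂| ≤ B` give
`xy ≤ D₁D₂ + 2BE + E²`. [folklore] -/
theorem mul_le_of_abs_sub_le {x y D₁ D₂ E B : ℝ} (hx : |x - D₁| ≤ E) (hy : |y - D₂| ≤ E)
    (hD₁ : |D₁| ≤ B) (hD₂ : |D₂| ≤ B) :
    x * y ≤ D₁ * D₂ + 2 * B * E + E ^ 2 := by
  obtain ⟨hx1, hx2⟩ := abs_le.mp hx
  obtain ⟨hy1, hy2⟩ := abs_le.mp hy
  obtain ⟨hD1, hD2⟩ := abs_le.mp hD₁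
  obtain ⟨hD3, hD4⟩ := abs_le.mp hD₂
  nlinarith [mul_nonneg (by linarith : (0 : ℝ) ≤ B + D₁) (by linarith : (0 : ℝ) ≤ E - (y - D₂)),
    mul_nonneg (by linarith : (0 : ℝ) ≤ B - D₁) (by linarith : (0 : ℝ) ≤ E + (y - D₂)),
    mul_nonneg (by linarith : (0 : ℝ) ≤ B + D₂) (by linarith : (0 : ℝ) ≤ E - (x - D₁)),
    mul_nonneg (by linarith : (0 : ℝ) ≤ B - D₂) (by linarith : (0 : ℝ) ≤ E + (x - D₁)),
    mul_nonneg (by linarith : (0 : ℝ) ≤ E + (x - D₁)) (by linarith : (0 : ℝ) ≤ E - (y - D₂)),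
    mul_nonneg (by linarith : (0 : ℝ) ≤ E - (x - D₁)) (by linarith : (0 : ℝ) ≤ E + (y - D₂))]

/-- **GS21 (Sq4) for an even character, as a lower bound.** Let `χ ≠ χ₀` be a real character mod
`q` with `χ(−1) = 1`, and suppose `|Ψ(ρ; q, b) − (M − χ(b)S)| ≤ E` for every reduced class `b`
(`M, S ≥ 0`). Then `∑_b Ψ_bΨ_{−b} ≥ φ(q)(M² + S² − 2(M + S)E − E²)`: drop the classes
`(b, q) > 1`, expand `(M − χ(b)S)²`, and use `∑_b χ(b) = 0` ("the sum of a Dirichlet character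
over a reduced residue class vanishes, and … `χ₁(b)χ₁(−b) = χ₁(−1)`").
[cite: GoldstonSuriajaya2021, §4 (Sq4)] -/
theorem genPairSum_ge_of_even {q : ℕ} [NeZero q] {χ : DirichletCharacter ℂ q} (hχ1 : χ ≠ 1)
    (hχ : χ.IsQuadratic) (heven : χ.Even) (hρ0 : 0 ≤ ρ) {M S E : ℝ} (hM : 0 ≤ M) (hS : 0 ≤ S)
    (happrox : ∀ b : ZMod q, IsUnit b → |psiGen q b ρ - (M - (χ b).re * S)| ≤ E) :
    (Nat.totient q : ℝ) * (M ^ 2 + S ^ 2 - 2 * (M + S) * E - E ^ 2) ≤ genPairSum q ρ := by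
  unfold genPairSum
  have hterm : ∀ b ∈ (univ : Finset (ZMod q)),
      (if IsUnit b then M ^ 2 + S ^ 2 - 2 * (M + S) * E - E ^ 2 else 0) - 2 * (M * S) * (χ b).re ≤
        psiGen q b ρ * psiGen q (-b) ρ := by
    intro b _
    by_cases hb : IsUnit b
    · rw [if_pos hb]
      have hb' : IsUnit (-b) := hb.neg
      have hre : (χ (-b)).re = (χ b).re := by rw [heven.eval_neg]
      have h1 := happrox b hb
      have h2 := happrox (-b) hb'
      rw [hre] at h2
      have hD : |M - (χ b).re * S| ≤ M + S := by
        rcases re_apply_unit hχ hb with h | h <;> rw [h, abs_le] <;> constructor <;> nlinarith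
      have h := mul_ge_of_abs_sub_le h1 h2 hD
      have hsq : (χ b).re ^ 2 = 1 := by
        rcases re_apply_unit hχ hb with h | h <;> rw [h] <;> norm_num
      nlinarith
    · rw [if_neg hb, MulChar.map_nonunit χ hb, Complex.zero_re, mul_zero, sub_zero]
      exact mul_nonneg (psiGen_nonneg q b hρ0) (psiGen_nonneg q (-b) hρ0)
  have hsum := Finset.sum_le_sum hterm
  rw [sum_sub_distrib, sum_ite_isUnit_const, ← mul_sum, sum_re_apply_eq_zero hχ1, mul_zero,
    sub_zero] at hsum
  exact hsum

/-- `Z₀ = ∑_{(b, q) > 1} Ψ(ρ; q, b)`, the generating function of the prime powers not coprime to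
`q` (GS21 (Sq3)/(Psi(d>1)): the classes with `(b, q) = d > 1`). [cite: GoldstonSuriajaya2021, §4 (Sq3)] -/
def nonUnitGen (q : ℕ) [NeZero q] (ρ : ℝ) : ℝ :=
  ∑ b ∈ (univ : Finset (ZMod q)).filter (fun b => ¬IsUnit b), psiGen q b ρ

/-- `Z₀ ≥ 0`. [folklore] -/
theorem nonUnitGen_nonneg (q : ℕ) [NeZero q] (hρ0 : 0 ≤ ρ) : 0 ≤ nonUnitGen q ρ :=
  sum_nonneg fun b _ => psiGen_nonneg q b hρ0

/-- The classes `(b, q) > 1` contribute at most `Z₀²` to `∑_b Ψ_bΨ_{−b}` (GS21 (Sq3)).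
[cite: GoldstonSuriajaya2021, §4 (Sq3)] -/
theorem sum_filter_not_isUnit_le (q : ℕ) [NeZero q] (hρ0 : 0 ≤ ρ) :
    ∑ b ∈ (univ : Finset (ZMod q)).filter (fun b => ¬IsUnit b), psiGen q b ρ * psiGen q (-b) ρ ≤
      nonUnitGen q ρ ^ 2 := by
  have hle : ∀ b ∈ (univ : Finset (ZMod q)).filter (fun b => ¬IsUnit b),
      psiGen q b ρ * psiGen q (-b) ρ ≤ psiGen q b ρ * nonUnitGen q ρ := by
    intro b hb
    rw [mem_filter] at hb
    refine mul_le_mul_of_nonneg_left ?_ (psiGen_nonneg q b hρ0)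
    have hmem : -b ∈ (univ : Finset (ZMod q)).filter (fun b => ¬IsUnit b) := by
      rw [mem_filter]
      exact ⟨mem_univ _, fun h => hb.2 ((IsUnit.neg_iff b).mp h)⟩
    exact single_le_sum (f := fun b' => psiGen q b' ρ) (fun b' _ => psiGen_nonneg q b' hρ0) hmem
  calc ∑ b ∈ (univ : Finset (ZMod q)).filter (fun b => ¬IsUnit b), psiGen q b ρ * psiGen q (-b) ρ
      ≤ ∑ b ∈ (univ : Finset (ZMod q)).filter (fun b => ¬IsUnit b), psiGen q b ρ * nonUnitGen q ρ :=
        sum_le_sum hle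
    _ = nonUnitGen q ρ ^ 2 := by rw [← sum_mul, nonUnitGen, sq]

/-- **GS21 (Sq4) for an odd character, as an upper bound.** Let `χ` be a real character mod `q`
with `χ(−1) = −1`, and suppose `|Ψ(ρ; q, b) − (M − χ(b)S)| ≤ E` for every reduced class `b`
(`M, S ≥ 0`). Then `∑_b Ψ_bΨ_{−b} ≤ φ(q)(M² − S² + 2(M + S)E + E²) + Z₀²`: on the reduced
classes `(M − χ(b)S)(M − χ(−b)S) = (M − χ(b)S)(M + χ(b)S) = M² − S²`
("`χ₁(b)χ₁(−b) = χ₁(−1)`"), and the other classes give at most `Z₀²`.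
[cite: GoldstonSuriajaya2021, §4 (Sq3), (Sq4)] -/
theorem genPairSum_le_of_odd {q : ℕ} [NeZero q] {χ : DirichletCharacter ℂ q}
    (hχ : χ.IsQuadratic) (hodd : χ.Odd) (hρ0 : 0 ≤ ρ) {M S E : ℝ} (hM : 0 ≤ M) (hS : 0 ≤ S)
    (happrox : ∀ b : ZMod q, IsUnit b → |psiGen q b ρ - (M - (χ b).re * S)| ≤ E) :
    genPairSum q ρ ≤
      (Nat.totient q : ℝ) * (M ^ 2 - S ^ 2 + 2 * (M + S) * E + E ^ 2) + nonUnitGen q ρ ^ 2 := by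
  unfold genPairSum
  rw [← sum_filter_add_sum_filter_not univ (fun b : ZMod q => IsUnit b)]
  refine add_le_add ?_ (sum_filter_not_isUnit_le q hρ0)
  have hterm : ∀ b ∈ (univ : Finset (ZMod q)).filter (fun b => IsUnit b),
      psiGen q b ρ * psiGen q (-b) ρ ≤ M ^ 2 - S ^ 2 + 2 * (M + S) * E + E ^ 2 := by
    intro b hb
    rw [mem_filter] at hb
    have hb' : IsUnit (-b) := hb.2.neg
    have hre : (χ (-b)).re = -(χ b).re := by rw [hodd.eval_neg, Complex.neg_re]
    have h1 := happrox b hb.2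
    have h2 := happrox (-b) hb'
    rw [hre] at h2
    have hD₁ : |M - (χ b).re * S| ≤ M + S := by
      rcases re_apply_unit hχ hb.2 with h | h <;> rw [h, abs_le] <;> constructor <;> nlinarith
    have hD₂ : |M - -(χ b).re * S| ≤ M + S := by
      rcases re_apply_unit hχ hb.2 with h | h <;> rw [h, abs_le] <;> constructor <;> nlinarith
    have h := mul_le_of_abs_sub_le h1 h2 hD₁ hD₂
    have hsq : (χ b).re ^ 2 = 1 := by
      rcases re_apply_unit hχ hb.2 with h | h <;> rw [h] <;> norm_num
    nlinarith
  calc ∑ b ∈ (univ : Finset (ZMod q)).filter (fun b => IsUnit b), psiGen q b ρ * psiGen q (-b) ρ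
      ≤ ∑ _b ∈ (univ : Finset (ZMod q)).filter (fun b => IsUnit b),
          (M ^ 2 - S ^ 2 + 2 * (M + S) * E + E ^ 2) := sum_le_sum hterm
    _ = (Nat.totient q : ℝ) * (M ^ 2 - S ^ 2 + 2 * (M + S) * E + E ^ 2) := by
        rw [sum_const, nsmul_eq_mul]
        congr 1
        have h := sum_ite_isUnit_const (q := q) (1 : ℝ)
        rw [← sum_filter, sum_const, nsmul_eq_mul, mul_one, mul_one] at h
        exact h

end GoldstonSuriajaya

end Literature.Barriers.Parity
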